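import Literature.AlgebraicTopology.SingularHomology.TowerMilnorSequence
import Mathlib.LinearAlgebra.Dual.Lemmas
import Mathlib.LinearAlgebra.DFinsupp
import HarnessLib

/-!
# `lim¹ = 0` for a tower of finite-dimensional vector spaces (Mittag-Leffler), and compatible
# preimages along a tower

C. Weibel, *An Introduction to Homological Algebra* (1994), §3.5: a tower `⋯ → M(1) → M(0)` of
finite-dimensional vector spaces over a field satisfies the Mittag-Leffler condition (the images
of `M(m) → M(n)` stabilise as `m → ∞`, by dimension), hence `lim¹ₙ M(n) = 0` (Prop. 3.5.7);
A. Hatcher, *Algebraic Topology* (2002), §3.F, p. 313 (the vanishing of `lim¹` that makes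
`Hᵏ(X; F) → limₙ Hᵏ(Xₙ; F)` an isomorphism for field coefficients and an exhaustion by subspaces
with finite-dimensional cohomology, Thm. 3F.8). For the tree's `lim¹` carrier `towerLim1 r` =
`coker (1 - shift)` of `TowerMilnorSequence.lean` (`towerD r = 1 - shift` on `Π M(n)`):

* `towerD_surjective_of_finiteDimensional`, `subsingleton_towerLim1_of_finiteDimensional` —
  **`1 - shift` is onto, i.e. `lim¹ₙ M(n) = 0`, for every tower of finite-dimensional vector
  spaces.** Proof by duality (which avoids the stabilisation bookkeeping): `M(n) = N(n)^*` for
  the direct system `N(n) = M(n)^*`, `Π M(n) = (⊕ N(n))^*`, and under these identifications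
  `1 - shift` is the transpose of the map `T = 1 - S : ⊕ N(n) → ⊕ N(n)`, `(S y)ₙ₊₁ = r^*(yₙ)`,
  `(S y)₀ = 0`, which is injective (if `y = S y` then `y₀ = 0` and `yₙ₊₁ = r^* yₙ`, so `y = 0`);
  the transpose of an injective linear map of vector spaces is onto
  (`LinearMap.dualMap_surjective_of_injective`).
* `exists_compatible_preimages_of_finiteDimensional` — **Mittag-Leffler for the affine
  subspaces `Φₙ⁻¹(cₙ)`**: for towers `V`, `W` with compatible linear maps `Φₙ : V(n) → W(n)`,
  `V(n)` finite-dimensional, and a compatible family `cₙ ∈ W(n)` each of which is a value of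
  `Φₙ`, there is a COMPATIBLE family `vₙ ∈ V(n)` with `Φₙ vₙ = cₙ` — choose preimages `aₙ`
  anyhow; the defects `r aₙ₊₁ - aₙ` lie in the tower `ker Φₙ` of finite-dimensional spaces,
  whose `1 - shift` is onto, which is exactly the correction needed.
* `towerD_surjective_of_finiteDimensional_range`, `subsingleton_towerLim1_of_finiteDimensional_range`,
  `exists_compatible_preimages_of_finiteDimensional_range` — the same three statements when only
  the transition maps have FINITE RANK (the Mittag-Leffler condition needs no more): modulo the
  finite-dimensional sub-tower of images the tower has zero transition maps. This is the form met
  by the cohomology `Hᵏ(Oₙ; F)` of an open exhaustion interleaved with compact pieces of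
  finite-dimensional cohomology (`Oₙ ⊆ Cₙ ⊆ Oₙ₊₁`).

These are the two algebraic inputs of the passage from the finite complexes to the whole space in
Leray-type computations of `H*(E; F)` over an exhaustion `E = ⋃ Eₙ` with `H*(Eₙ; F)`
finite-dimensional (Milnor's sequence `0 → lim¹ Hᵏ⁻¹(Eₙ) → Hᵏ(E) → lim Hᵏ(Eₙ) → 0`,
`CochainExhaustionMilnor.lean`). Everything is proved; no definitions, no named facts.

## References

* C. Weibel, *An Introduction to Homological Algebra*, CUP 1994, §3.5 Def. 3.5.1, Def. 3.5.6,
  Prop. 3.5.7. [Weibel1994]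
* A. Hatcher, *Algebraic Topology*, CUP 2002, §3.F p. 313 and Thm. 3F.8. [HatcherAT2002]
-/

noncomputable section

open Function Module

namespace Literature.AlgebraicTopology.SingularHomology

universe u v w

section FiniteDimensional

variable {K : Type u} [Field K] {M : ℕ → Type v} [∀ n, AddCommGroup (M n)] [∀ n, Module K (M n)]
  (r : ∀ n, M (n + 1) →ₗ[K] M n)

/-- **`lim¹ = 0` for a tower of finite-dimensional vector spaces: `1 - shift` is onto `Π M(n)`**
(Weibel 1994, Prop. 3.5.7: such a tower satisfies the Mittag-Leffler condition; Hatcher 2002,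
§3.F p. 313). Proof by duality: under the pairing `P : Π M(n) → (⊕ₙ M(n)^*)^*`,
`P(f)(y) = Σₙ yₙ(fₙ)` — a bijection for finite-dimensional `M(n)` (`M(n) ≅ M(n)^**` and
`(⊕ N(n))^* ≅ Π N(n)^*`) — the map `1 - shift` is the transpose of `T = 1 - S`,
`S(single n φ) = single (n+1) (r_n^* φ)`, which is injective (a `y` with `y = S y` has `y₀ = 0`
and `yₙ₊₁ = r_n^* yₙ`, hence vanishes); and transposes of injective linear maps of vector spaces
are onto (`LinearMap.dualMap_surjective_of_injective`).
[cite: Weibel1994, §3.5 Prop. 3.5.7] [cite: HatcherAT2002, §3.F p. 313] -/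
theorem towerD_surjective_of_finiteDimensional [∀ n, FiniteDimensional K (M n)] :
    Surjective (towerD r) := by
  classical
  -- the shift `S` on the direct sum of the duals
  set S : (Π₀ n, Dual K (M n)) →ₗ[K] (Π₀ n, Dual K (M n)) :=
    DFinsupp.lsum K fun n ↦ (DFinsupp.lsingle (n + 1)).comp (r n).dualMap with hS
  -- the pairing `P : Π M(n) ≅ (⊕ₙ M(n)^*)^*`, `P(f)(y) = Σₙ yₙ(fₙ)`:
  -- `Πₙ (M(n) ≅ M(n)^**)` followed by `Πₙ N(n)^* ≅ (⊕ₙ N(n))^*`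
  let P : (∀ n, M n) ≃ₗ[K] Dual K (Π₀ n, Dual K (M n)) :=
    (LinearEquiv.piCongrRight fun n ↦ evalEquiv K (M n)).trans (DFinsupp.lsum K)
  have hS_single : ∀ (n : ℕ) (φ : Dual K (M n)),
      S (DFinsupp.single n φ) = DFinsupp.single (n + 1) ((r n).dualMap φ) := fun n φ ↦ by
    rw [hS, DFinsupp.lsum_single, LinearMap.comp_apply, DFinsupp.lsingle_apply]
  have hP_single : ∀ (f : ∀ n, M n) (n : ℕ) (φ : Dual K (M n)),
      P f (DFinsupp.single n φ) = φ (f n) := fun f n φ ↦ by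
    show DFinsupp.lsum K ((LinearEquiv.piCongrRight fun n ↦ evalEquiv K (M n)) f)
      (DFinsupp.single n φ) = φ (f n)
    rw [DFinsupp.lsum_single, LinearEquiv.piCongrRight_apply, evalEquiv_apply, Dual.eval_apply]
  -- components of `S y`: nothing in degree `0`, `(S y)ₙ₊₁ = r_n^*(yₙ)`
  have hS0 : ∀ y, S y 0 = 0 := fun y ↦ by
    induction y using DFinsupp.induction with
    | h0 => rw [map_zero, DFinsupp.zero_apply]
    | ha i b f _ _ ih =>
      rw [map_add, DFinsupp.add_apply, ih, add_zero, hS_single,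
        DFinsupp.single_eq_of_ne (Nat.succ_ne_zero i).symm]
  have hSsucc : ∀ y (n : ℕ), S y (n + 1) = (r n).dualMap (y n) := fun y n ↦ by
    induction y using DFinsupp.induction with
    | h0 => rw [map_zero, DFinsupp.zero_apply, DFinsupp.zero_apply, map_zero]
    | ha i b f _ _ ih =>
      rw [map_add, DFinsupp.add_apply, ih, DFinsupp.add_apply, map_add, hS_single]
      by_cases hi : i = n
      · subst hi
        rw [DFinsupp.single_eq_same, DFinsupp.single_eq_same]
      · rw [DFinsupp.single_eq_of_ne (fun h ↦ hi (Nat.succ_injective h).symm),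
          DFinsupp.single_eq_of_ne (Ne.symm hi), map_zero]
  -- `T = 1 - S` is injective
  let T : (Π₀ n, Dual K (M n)) →ₗ[K] (Π₀ n, Dual K (M n)) :=
    { toFun := fun y ↦ y - S y
      map_add' := fun a b ↦ by rw [map_add]; abel
      map_smul' := fun c a ↦ by
        simp only [map_smul, RingHom.id_apply]
        exact (smul_sub c a (S a)).symm }
  have hT_apply : ∀ y, T y = y - S y := fun y ↦ rfl
  have hT : Injective T := by
    refine (injective_iff_map_eq_zero _).2 fun y hy ↦ ?_
    have hy' : ∀ n, y n = S y n := fun n ↦ by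
      have := DFunLike.congr_fun hy n
      rwa [hT_apply, DFinsupp.sub_apply, DFinsupp.zero_apply, sub_eq_zero] at this
    have h : ∀ n, y n = 0 := by
      intro n
      induction n with
      | zero => rw [hy' 0, hS0]
      | succ n ih => rw [hy' (n + 1), hSsucc, ih, map_zero]
    exact DFinsupp.ext h
  -- `P ∘ (1 - shift) = T^* ∘ P`
  have hPD : ∀ f, P (towerD r f) = T.dualMap (P f) := fun f ↦ by
    refine DFinsupp.lhom_ext fun n φ ↦ ?_
    rw [LinearMap.dualMap_apply, hT_apply, map_sub (P f), hS_single, hP_single, hP_single,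
      hP_single, towerD_apply, map_sub φ, LinearMap.dualMap_apply]
  -- conclusion: `T^*` is onto and `P` is bijective
  intro x
  obtain ⟨χ, hχ⟩ := LinearMap.dualMap_surjective_of_injective (K := K)
    (V₁ := Π₀ n, Dual K (M n)) (V₂ := Π₀ n, Dual K (M n)) hT (P x)
  refine ⟨P.symm χ, P.injective ?_⟩
  rw [hPD, LinearEquiv.apply_symm_apply, hχ]

/-- **`lim¹ₙ M(n) = 0` for a tower of finite-dimensional vector spaces** (Weibel 1994,
Prop. 3.5.7; Hatcher 2002, §3.F p. 313), on the tree's carrier `towerLim1 = coker (1 - shift)`.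
[cite: Weibel1994, §3.5 Prop. 3.5.7] [cite: HatcherAT2002, §3.F p. 313] -/
theorem subsingleton_towerLim1_of_finiteDimensional [∀ n, FiniteDimensional K (M n)] :
    Subsingleton (towerLim1 r) := by
  refine ⟨fun a b ↦ ?_⟩
  induction a using Submodule.Quotient.induction_on with
  | H a =>
    induction b using Submodule.Quotient.induction_on with
    | H b =>
      rw [Submodule.Quotient.eq,
        LinearMap.range_eq_top.2 (towerD_surjective_of_finiteDimensional r)]
      exact Submodule.mem_top

end FiniteDimensional

/-! ### Compatible preimages along a tower (Mittag-Leffler for the affine subspaces `Φₙ⁻¹(cₙ)`) -/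

section Preimages

variable {K : Type u} [Field K] {V : ℕ → Type v} {W : ℕ → Type w} [∀ n, AddCommGroup (V n)] [∀ n, Module K (V n)]
  [∀ n, AddCommGroup (W n)] [∀ n, Module K (W n)] [∀ n, FiniteDimensional K (V n)]

/-- **Compatible preimages along a tower.** Let `ρₙ : V(n+1) → V(n)` and `σₙ : W(n+1) → W(n)` be
towers of vector spaces with `V(n)` finite-dimensional, `Φₙ : V(n) → W(n)` linear maps commuting
with the towers, and `cₙ ∈ W(n)` a compatible family (`σₙ cₙ₊₁ = cₙ`) with every `cₙ` a value of
`Φₙ`. Then there is a compatible family `vₙ ∈ V(n)` (`ρₙ vₙ₊₁ = vₙ`) with `Φₙ vₙ = cₙ` for all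
`n` — the nonempty affine subspaces `Φₙ⁻¹(cₙ)` form a Mittag-Leffler tower with nonempty
limit. Proof: for arbitrary preimages `aₙ` the defects `xₙ = ρₙ aₙ₊₁ - aₙ` lie in the tower
`Uₙ = ker Φₙ` of finite-dimensional spaces, on which `1 - shift` is onto
(`towerD_surjective_of_finiteDimensional`): `uₙ - ρₙ uₙ₊₁ = -xₙ` is solvable, and
`vₙ = aₙ + uₙ` is compatible. [cite: Weibel1994, §3.5 Prop. 3.5.7]
[cite: HatcherAT2002, §3.F p. 313] -/
theorem exists_compatible_preimages_of_finiteDimensional (ρ : ∀ n, V (n + 1) →ₗ[K] V n)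
    (σ : ∀ n, W (n + 1) →ₗ[K] W n) (Φ : ∀ n, V n →ₗ[K] W n)
    (hΦ : ∀ n (x : V (n + 1)), σ n (Φ (n + 1) x) = Φ n (ρ n x))
    (c : ∀ n, W n) (hc : ∀ n, σ n (c (n + 1)) = c n) (hcΦ : ∀ n, c n ∈ LinearMap.range (Φ n)) :
    ∃ v : ∀ n, V n, (∀ n, ρ n (v (n + 1)) = v n) ∧ ∀ n, Φ n (v n) = c n := by
  choose a ha using fun n ↦ LinearMap.mem_range.1 (hcΦ n)
  -- the tower of kernels and the defects
  have hρU : ∀ n (x : ↥(LinearMap.ker (Φ (n + 1)))), ρ n (x : V (n + 1)) ∈ LinearMap.ker (Φ n) :=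
    fun n x ↦ by rw [LinearMap.mem_ker, ← hΦ, LinearMap.mem_ker.1 x.2, map_zero]
  let ρU : ∀ n, ↥(LinearMap.ker (Φ (n + 1))) →ₗ[K] ↥(LinearMap.ker (Φ n)) :=
    fun n ↦ ((ρ n).domRestrict _).codRestrict _ (hρU n)
  have hx : ∀ n, a n - ρ n (a (n + 1)) ∈ LinearMap.ker (Φ n) := fun n ↦ by
    rw [LinearMap.mem_ker, map_sub, ← hΦ, ha, ha, hc, sub_self]
  -- `lim¹ (ker Φₙ) = 0`: solve `uₙ - ρ uₙ₊₁ = -(aₙ - ρ aₙ₊₁)`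
  obtain ⟨u, hu⟩ := towerD_surjective_of_finiteDimensional
    (M := fun n ↦ ↥(LinearMap.ker (Φ n))) ρU fun n ↦ -⟨a n - ρ n (a (n + 1)), hx n⟩
  have hu' : ∀ n, (u n : V n) - ρ n (u (n + 1) : V (n + 1)) = -(a n - ρ n (a (n + 1))) := by
    intro n
    have h := congrArg (fun y : ↥(LinearMap.ker (Φ n)) ↦ (y : V n)) (congrFun hu n)
    simpa [towerD_apply, ρU] using h
  refine ⟨fun n ↦ a n + (u n : V n), fun n ↦ ?_, fun n ↦ ?_⟩
  · have h1 := hu' n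
    rw [sub_eq_iff_eq_add] at h1
    show ρ n (a (n + 1) + (u (n + 1) : V (n + 1))) = a n + (u n : V n)
    rw [map_add, h1]
    abel
  · show Φ n (a n + (u n : V n)) = c n
    rw [map_add, ha, LinearMap.mem_ker.1 (u n).2, add_zero]

end Preimages

/-! ### Towers whose transition maps have finite rank -/

section FiniteRank

variable {K : Type u} [Field K] {M : ℕ → Type v} [∀ n, AddCommGroup (M n)] [∀ n, Module K (M n)]
  (r : ∀ n, M (n + 1) →ₗ[K] M n)

/-- **`lim¹ = 0` for a tower of vector spaces whose transition maps have finite rank** (the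
Mittag-Leffler condition holds as soon as the IMAGES are finite-dimensional; Weibel 1994,
Prop. 3.5.7 — e.g. the tower `Hᵏ(Oₙ; F)` of an open exhaustion interleaved with compact pieces
of finite-dimensional cohomology, `Oₙ ⊆ Cₙ ⊆ Oₙ₊₁`, whose transition maps factor through the
`Hᵏ(Cₙ; F)`). Proof: modulo the sub-tower of images `M'(n) = rₙ(M(n+1))` (finite-dimensional,
so `lim¹ M' = 0` by `towerD_surjective_of_finiteDimensional`) the tower has ZERO transition maps,
for which `1 - shift = 1`; concretely `y = x + u` solves `(1 - shift) y = x` when `u ∈ Π M'(n)`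
solves `(1 - shift) u = (rₙ xₙ₊₁)ₙ`. [cite: Weibel1994, §3.5 Prop. 3.5.7]
[cite: HatcherAT2002, §3.F p. 313] -/
theorem towerD_surjective_of_finiteDimensional_range
    [∀ n, FiniteDimensional K ↥(LinearMap.range (r n))] : Surjective (towerD r) := by
  -- the sub-tower of images, with the restricted maps
  have hr' : ∀ n (y : ↥(LinearMap.range (r (n + 1)))),
      r n (y : M (n + 1)) ∈ LinearMap.range (r n) := fun n y ↦ LinearMap.mem_range_self _ _
  let r' : ∀ n, ↥(LinearMap.range (r (n + 1))) →ₗ[K] ↥(LinearMap.range (r n)) :=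
    fun n ↦ ((r n).domRestrict _).codRestrict _ (hr' n)
  intro x
  obtain ⟨u, hu⟩ := towerD_surjective_of_finiteDimensional
    (M := fun n ↦ ↥(LinearMap.range (r n))) r' fun n ↦ ⟨r n (x (n + 1)), LinearMap.mem_range_self _ _⟩
  have hu' : ∀ n, (u n : M n) - r n (u (n + 1) : M (n + 1)) = r n (x (n + 1)) := by
    intro n
    have h := congrArg (fun y : ↥(LinearMap.range (r n)) ↦ (y : M n)) (congrFun hu n)
    simpa [towerD_apply, r'] using h
  refine ⟨fun n ↦ x n + (u n : M n), funext fun n ↦ ?_⟩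
  show (x n + (u n : M n)) - r n (x (n + 1) + (u (n + 1) : M (n + 1))) = x n
  rw [map_add, ← hu' n]
  abel

/-- **`lim¹ₙ M(n) = 0` for a tower whose transition maps have finite rank**, on the tree's carrier
`towerLim1 = coker (1 - shift)`. [cite: Weibel1994, §3.5 Prop. 3.5.7] -/
theorem subsingleton_towerLim1_of_finiteDimensional_range
    [∀ n, FiniteDimensional K ↥(LinearMap.range (r n))] : Subsingleton (towerLim1 r) := by
  refine ⟨fun a b ↦ ?_⟩
  induction a using Submodule.Quotient.induction_on with
  | H a =>
    induction b using Submodule.Quotient.induction_on with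
    | H b =>
      rw [Submodule.Quotient.eq,
        LinearMap.range_eq_top.2 (towerD_surjective_of_finiteDimensional_range r)]
      exact Submodule.mem_top

variable {V : ℕ → Type v} {W : ℕ → Type w} [∀ n, AddCommGroup (V n)] [∀ n, Module K (V n)]
  [∀ n, AddCommGroup (W n)] [∀ n, Module K (W n)]

/-- **Compatible preimages along a tower whose transition maps have finite rank** (the form of
`exists_compatible_preimages_of_finiteDimensional` for towers such as `Hᵏ(Oₙ; F)` above, which
are not finite-dimensional but have finite-rank transition maps): with `ρₙ` of finite rank,
compatible `Φₙ : V(n) → W(n)` and a compatible family `cₙ` of values of the `Φₙ`, there is a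
compatible family `vₙ` with `Φₙ vₙ = cₙ`. Same proof: the kernel tower `ker Φₙ` has transition
maps of finite rank (their images embed in those of the `ρₙ`), so its `1 - shift` is onto
(`towerD_surjective_of_finiteDimensional_range`). [cite: Weibel1994, §3.5 Prop. 3.5.7]
[cite: HatcherAT2002, §3.F p. 313] -/
theorem exists_compatible_preimages_of_finiteDimensional_range (ρ : ∀ n, V (n + 1) →ₗ[K] V n)
    [∀ n, FiniteDimensional K ↥(LinearMap.range (ρ n))]
    (σ : ∀ n, W (n + 1) →ₗ[K] W n) (Φ : ∀ n, V n →ₗ[K] W n)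
    (hΦ : ∀ n (x : V (n + 1)), σ n (Φ (n + 1) x) = Φ n (ρ n x))
    (c : ∀ n, W n) (hc : ∀ n, σ n (c (n + 1)) = c n) (hcΦ : ∀ n, c n ∈ LinearMap.range (Φ n)) :
    ∃ v : ∀ n, V n, (∀ n, ρ n (v (n + 1)) = v n) ∧ ∀ n, Φ n (v n) = c n := by
  choose a ha using fun n ↦ LinearMap.mem_range.1 (hcΦ n)
  -- the tower of kernels and the defects
  have hρU : ∀ n (x : ↥(LinearMap.ker (Φ (n + 1)))), ρ n (x : V (n + 1)) ∈ LinearMap.ker (Φ n) :=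
    fun n x ↦ by rw [LinearMap.mem_ker, ← hΦ, LinearMap.mem_ker.1 x.2, map_zero]
  let ρU : ∀ n, ↥(LinearMap.ker (Φ (n + 1))) →ₗ[K] ↥(LinearMap.ker (Φ n)) :=
    fun n ↦ ((ρ n).domRestrict _).codRestrict _ (hρU n)
  -- the kernel tower has transition maps of finite rank: `range ρUₙ ↪ range ρₙ`
  haveI : ∀ n, FiniteDimensional K ↥(LinearMap.range (ρU n)) := fun n ↦ by
    have hg : ∀ y : ↥(LinearMap.range (ρU n)), ((y : ↥(LinearMap.ker (Φ n))) : V n) ∈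
        LinearMap.range (ρ n) := by
      rintro ⟨_, z, rfl⟩
      exact LinearMap.mem_range_self _ _
    let g : ↥(LinearMap.range (ρU n)) →ₗ[K] ↥(LinearMap.range (ρ n)) :=
      (((LinearMap.ker (Φ n)).subtype.comp (LinearMap.range (ρU n)).subtype)).codRestrict _ hg
    refine Module.Finite.of_injective g fun y y' h ↦ ?_
    have h' : (((y : ↥(LinearMap.ker (Φ n))) : V n)) = ((y' : ↥(LinearMap.ker (Φ n))) : V n) :=
      congrArg (fun z : ↥(LinearMap.range (ρ n)) ↦ (z : V n)) h
    exact Subtype.ext (Subtype.ext h')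
  have hx : ∀ n, a n - ρ n (a (n + 1)) ∈ LinearMap.ker (Φ n) := fun n ↦ by
    rw [LinearMap.mem_ker, map_sub, ← hΦ, ha, ha, hc, sub_self]
  obtain ⟨u, hu⟩ := towerD_surjective_of_finiteDimensional_range
    (M := fun n ↦ ↥(LinearMap.ker (Φ n))) ρU fun n ↦ -⟨a n - ρ n (a (n + 1)), hx n⟩
  have hu' : ∀ n, (u n : V n) - ρ n (u (n + 1) : V (n + 1)) = -(a n - ρ n (a (n + 1))) := by
    intro n
    have h := congrArg (fun y : ↥(LinearMap.ker (Φ n)) ↦ (y : V n)) (congrFun hu n)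
    simpa [towerD_apply, ρU] using h
  refine ⟨fun n ↦ a n + (u n : V n), fun n ↦ ?_, fun n ↦ ?_⟩
  · have h1 := hu' n
    rw [sub_eq_iff_eq_add] at h1
    show ρ n (a (n + 1) + (u (n + 1) : V (n + 1))) = a n + (u n : V n)
    rw [map_add, h1]
    abel
  · show Φ n (a n + (u n : V n)) = c n
    rw [map_add, ha, LinearMap.mem_ker.1 (u n).2, add_zero]

end FiniteRank

end Literature.AlgebraicTopology.SingularHomology

end
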